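import Mathlib.Algebra.MvPolynomial.Basic
import Mathlib.RingTheory.Ideal.Operations
import Mathlib.RingTheory.Ideal.Maps
import Mathlib.Algebra.Group.Pointwise.Finset.Basic
import HarnessLib

/-!
# [OURS · L1 W3.6 / K3.6 specimen (B)] Symbolic powers of the ideal of THREE CONCURRENT LINES in `k[x,y,z]`:
# `I^{(2)} = I² + (xyz) ≠ I²` (the ord-pow door FAILS) but `I^{(2m)} = (I^{(2)})^m` (VERONESE STABILITY AT LEVEL 2 HOLDS)

Cell `res-hironaka`, rung L of LADDER-RESOLUTION, slot W3.6 «ORD-POW CUT» / kill test K3.6 (RESCUE-SEED v0.6.3 §1 W3.6),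
specimen (B) «three concurrent lines» (`Z = 𝔸⁴`, `E_B = ((w²) + (xy,yz,zx)^M·𝒪, 2)`, `Σ̄_max` predicted = the three coordinate axes of the
`(x,y,z)`-space; res-type-010 K3.6 AMENDMENT 1 2026-08-27T01:04:14Z «(B) predicted level-2 core focus»; res-adj-3 GAP-AMEND R12 01:1xZ).
HOST (custody, no new route): `Theses.MarkedTransfer.HypersurfaceOrderReduction` (stmt-ResolutionOfSingularities-16155), `--supports …
--as helper`, like the W3.1 helper files. Author seat: res-type-009 (RESERVE), STATUS 2026-08-27T01:17:30Z.

HONEST FRAMING. Elementary commutative algebra about monomial ideals in `k[x,y,z]` over a commutative ring `k`; NOTHING here is a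
statement of H. Hironaka's manuscript (2017, [Hironaka2017]) and no candidate statement of it is used as a premise. It is the
RING-LEVEL certificate behind the «level-2» prediction for specimen (B): with `I = (xy, yz, zx)` the radical ideal of the three coordinate
axes `C ⊂ 𝔸³` and `I^{(n)} := (x,y)^n ∩ (y,z)^n ∩ (z,x)^n` (the intersection of the `n`-th powers of its three minimal primes —
the classical `n`-th symbolic power; for these primes, generated by variables, `P^n` is `P`-primary, not re-proved here),
* `mem_symbPow_iff` — `f ∈ I^{(n)}` iff EVERY exponent `d` in the support of `f` has `d₀+d₁ ≥ n`, `d₁+d₂ ≥ n`, `d₀+d₂ ≥ n`;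
* `symbPow_one` — `I^{(1)} = I`; `symbPow_succ_succ` — **`I^{(n+2)} = I·I^{(n+1)} + (xyz)·I^{(n)}`** (the symbolic Rees algebra is
  generated by `I` in degree 1 and `xyz` in degree 2); `symbPow_two` — `I^{(2)} = I² + (xyz)`;
* companion file `MarkedTransferCampaignW36ThreeLinesVeronese.lean`: `xyz ∉ I²` (so `I^{(2)} ≠ I²`: the ord-pow door FAILS for
  this cut) and **`(I^{(2)})^m = I^{(2m)}`** (VERONESE STABILITY at level `N = 2`, the hypothesis shape of
  `Lib/CoreFocusVeronese.stableAt_of_veronese`, res-type-010 p480948, at the ring level).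
The SHEAF-level statement for `Σ̄_max(E_B) ⊂ 𝔸⁴` (identifying `diffPower C b` with these ideals, the extra transversal parameter
`w`, and `StableAt`) is NOT claimed here. AI-produced kernel evidence, weaker than expert review.

References (context only): RESCUE-SEED v0.6.3 §1 W3.6 / SIZED-ASK-L §K2 K3.6; res-L1-type-o4 NOTE 2026-08-26T23:59:42Z; res-type-010
K3.6 AMENDMENT 1 and `Lib/CoreFocusVeronese.lean` p480948. Classical context (not a premise): the symbolic Rees algebra of the three
coordinate lines is `R[It, xyz·t²]`.
-/

noncomputable section

set_option linter.dupNamespace false -- mandated namespace of this single-conjunct summit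

namespace Summit.ResolutionOfSingularities.ResolutionOfSingularities.Theorems

namespace CampaignW36

namespace ThreeLines

open MvPolynomial
open scoped Pointwise

variable {k : Type*} [CommRing k]

/-- The polynomial ring `k[x,y,z] = k[X 0, X 1, X 2]` of the specimen (plumbing abbreviation). -/
abbrev R (k : Type*) [CommRing k] : Type _ := MvPolynomial (Fin 3) k

/-! ## Weight ideals: `{f | every exponent d in the support of f has n ≤ w d}` for an additive weight `w` -/

/-- **The weight ideal `W_w(n)`** of an additive weight `w : (Fin 3 →₀ ℕ) →+ ℕ`: all polynomials every monomial of which has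
`w`-weight at least `n` (plumbing definition; e.g. `w d = d i + d j` gives the powers of `(X i, X j)`, `w d = |d|` the powers
of the irrelevant ideal). -/
def wIdeal (w : (Fin 3 →₀ ℕ) →+ ℕ) (n : ℕ) : Ideal (R k) where
  carrier := {f | ∀ d ∈ f.support, n ≤ w d}
  zero_mem' := by
    intro d hd
    simp at hd
  add_mem' := by
    classical
    intro f g hf hg d hd
    rcases Finset.mem_union.mp (support_add hd) with h | h
    · exact hf d h
    · exact hg d h
  smul_mem' := by
    classical
    intro c f hf d hd
    rw [smul_eq_mul] at hd
    obtain ⟨a, ha, b, hb, rfl⟩ := Finset.mem_add.mp (support_mul c f hd)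
    rw [map_add]
    exact le_add_left (hf b hb)

/-- Membership in a weight ideal (definitional unfolding). -/
theorem mem_wIdeal_iff {w : (Fin 3 →₀ ℕ) →+ ℕ} {n : ℕ} {f : R k} :
    f ∈ wIdeal w n ↔ ∀ d ∈ f.support, n ≤ w d := Iff.rfl

/-- `W_w(a) · W_w(b) ⊆ W_w(a+b)` (weights add on products of monomials). -/
theorem wIdeal_mul_le (w : (Fin 3 →₀ ℕ) →+ ℕ) (a b : ℕ) :
    wIdeal (k := k) w a * wIdeal w b ≤ wIdeal w (a + b) := by
  classical
  rw [Ideal.mul_le]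
  intro f hf g hg d hd
  obtain ⟨u, hu, v, hv, rfl⟩ := Finset.mem_add.mp (support_mul f g hd)
  rw [map_add]
  exact add_le_add (hf u hu) (hg v hv)

/-- `W_w(a)^m ⊆ W_w(m·a)`. -/
theorem wIdeal_pow_le (w : (Fin 3 →₀ ℕ) →+ ℕ) (a m : ℕ) :
    wIdeal (k := k) w a ^ m ≤ wIdeal w (m * a) := by
  induction m with
  | zero =>
    intro f _ d _
    simp
  | succ m ih =>
    rw [pow_succ, Nat.succ_mul]
    exact le_trans (Ideal.mul_mono_left ih) (wIdeal_mul_le w (m * a) a)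

/-- A monomial lies in `W_w(n)` as soon as its weight is `≥ n`. -/
theorem monomial_mem_wIdeal {w : (Fin 3 →₀ ℕ) →+ ℕ} {n : ℕ} {d : Fin 3 →₀ ℕ} (h : n ≤ w d) (c : k) :
    monomial d c ∈ wIdeal w n := by
  classical
  intro e he
  rw [support_monomial] at he
  split_ifs at he with hc
  · simp at he
  · rw [Finset.mem_singleton] at he
    subst he
    exact h

/-- A monomial with a non-zero coefficient lies in `W_w(n)` ONLY IF its weight is `≥ n`. -/
theorem le_of_monomial_mem_wIdeal {w : (Fin 3 →₀ ℕ) →+ ℕ} {n : ℕ} {d : Fin 3 →₀ ℕ} {c : k} (hc : c ≠ 0)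
    (h : monomial d c ∈ wIdeal w n) : n ≤ w d := by
  classical
  refine h d ?_
  rw [support_monomial, if_neg hc]
  exact Finset.mem_singleton_self d

/-- An ideal contains every member of `W_w(n)` as soon as it contains every monomial of weight `≥ n`. -/
theorem wIdeal_le_of_monomial_mem {w : (Fin 3 →₀ ℕ) →+ ℕ} {n : ℕ} {J : Ideal (R k)}
    (h : ∀ d : Fin 3 →₀ ℕ, n ≤ w d → monomial d (1 : k) ∈ J) : wIdeal w n ≤ J := by
  intro f hf
  rw [as_sum f]
  refine Submodule.sum_mem _ fun d hd => ?_
  have h1 : monomial d (coeff d f) = C (coeff d f) * monomial d (1 : k) := by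
    rw [C_mul_monomial, mul_one]
  rw [h1]
  exact Ideal.mul_mem_left _ _ (h d (hf d hd))

/-! ## The pair weights `d ↦ d i + d j` and the powers of `(X i, X j)` -/

/-- The additive weight `d ↦ d i + d j`. -/
def pairWeight (i j : Fin 3) : (Fin 3 →₀ ℕ) →+ ℕ :=
  Finsupp.applyAddHom i + Finsupp.applyAddHom j

/-- `pairWeight i j d = d i + d j`. -/
@[simp] theorem pairWeight_apply (i j : Fin 3) (d : Fin 3 →₀ ℕ) : pairWeight i j d = d i + d j := rfl

/-- The prime ideal `(X i, X j)` of a coordinate axis (for `i ≠ j`). -/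
def P (i j : Fin 3) : Ideal (R k) := Ideal.span {X i, X j}

/-- `X i ∈ (X i, X j)`. -/ theorem X_left_mem_P (i j : Fin 3) : (X i : R k) ∈ P i j := Ideal.subset_span (by simp)

/-- `X j ∈ (X i, X j)`. -/ theorem X_right_mem_P (i j : Fin 3) : (X j : R k) ∈ P i j := Ideal.subset_span (by simp)

/-- `(X i, X j) ⊆ W_{ij}(1)`. -/
theorem P_le_wIdeal_one (i j : Fin 3) : P (k := k) i j ≤ wIdeal (pairWeight i j) 1 := by
  rw [P, Ideal.span_le]
  intro f hf
  simp only [Set.mem_insert_iff, Set.mem_singleton_iff] at hf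
  rw [SetLike.mem_coe]
  rcases hf with rfl | rfl
  · have hX : (X i : R k) = monomial (Finsupp.single i 1) 1 := rfl
    rw [hX]; exact monomial_mem_wIdeal (by simp) 1
  · have hX : (X j : R k) = monomial (Finsupp.single j 1) 1 := rfl
    rw [hX]; exact monomial_mem_wIdeal (by simp) 1

/-- A monomial `X^d` with `d i + d j ≥ n` lies in `(X i, X j)^n` (for `i ≠ j`): `X^d = X_i^{d i} X_j^{d j} · X^{d'}`. -/
theorem monomial_mem_P_pow {i j : Fin 3} (hij : i ≠ j) {n : ℕ} {d : Fin 3 →₀ ℕ} (h : n ≤ d i + d j) :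
    monomial d (1 : k) ∈ P i j ^ n := by
  classical
  -- split `d = single i (d i) + single j (d j) + d'`
  set e : Fin 3 →₀ ℕ := Finsupp.single i (d i) + Finsupp.single j (d j) with he
  have hle : e ≤ d := by
    intro l
    simp only [he, Finsupp.coe_add, Pi.add_apply, Finsupp.single_apply]
    by_cases hl : i = l
    · subst hl
      have hjl : ¬ j = i := fun h => hij h.symm
      simp [hjl]
    · by_cases hl' : j = l
      · subst hl'
        simp [hl]
      · simp [hl, hl']
  have hd : d = e + (d - e) := (add_tsub_cancel_of_le hle).symm
  have hmon : monomial d (1 : k) = (X i ^ d i * X j ^ d j) * monomial (d - e) 1 := by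
    rw [X_pow_eq_monomial, X_pow_eq_monomial, monomial_mul, monomial_mul, mul_one, mul_one, ← he, ← hd]
  rw [hmon]
  refine Ideal.mul_mem_right _ _ ?_
  have h1 : X i ^ d i * X j ^ d j ∈ P (k := k) i j ^ (d i + d j) := by
    rw [pow_add]
    exact Ideal.mul_mem_mul (Ideal.pow_mem_pow (X_left_mem_P i j) _) (Ideal.pow_mem_pow (X_right_mem_P i j) _)
  exact Ideal.pow_le_pow_right h h1

/-- **`(X i, X j)^n = W_{ij}(n)`** (`i ≠ j`): a polynomial lies in the `n`-th power of the ideal of a coordinate axis iff every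
monomial in its support has `d i + d j ≥ n`. -/
theorem P_pow_eq_wIdeal {i j : Fin 3} (hij : i ≠ j) (n : ℕ) : P (k := k) i j ^ n = wIdeal (pairWeight i j) n := by
  refine le_antisymm ?_ (wIdeal_le_of_monomial_mem fun d hd => monomial_mem_P_pow hij hd)
  calc P i j ^ n ≤ wIdeal (pairWeight i j) 1 ^ n := Ideal.pow_right_mono (P_le_wIdeal_one i j) n
    _ ≤ wIdeal (pairWeight i j) (n * 1) := wIdeal_pow_le _ 1 n
    _ = wIdeal (pairWeight i j) n := by rw [mul_one]

/-! ## The ideal `I = (xy, yz, zx)` of the three axes and its symbolic powers `I^{(n)}` -/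

/-- **`I = (X₀X₁, X₁X₂, X₀X₂)`** — the (radical) ideal of the three coordinate axes in `𝔸³`. -/
def I : Ideal (R k) := Ideal.span {X 0 * X 1, X 1 * X 2, X 0 * X 2}

/-- **`I^{(n)} := (X₀,X₁)^n ∩ (X₁,X₂)^n ∩ (X₀,X₂)^n`** — the `n`-th symbolic power of `I` (intersection of the `n`-th powers of
its three minimal primes). -/
def symbPow (n : ℕ) : Ideal (R k) := P 0 1 ^ n ⊓ P 1 2 ^ n ⊓ P 0 2 ^ n

/-- **Monomial criterion**: `f ∈ I^{(n)}` iff every exponent `d` in the support of `f` satisfies `n ≤ d₀+d₁`, `n ≤ d₁+d₂`,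
`n ≤ d₀+d₂`. -/
theorem mem_symbPow_iff {n : ℕ} {f : R k} :
    f ∈ symbPow n ↔ ∀ d ∈ f.support, n ≤ d 0 + d 1 ∧ n ≤ d 1 + d 2 ∧ n ≤ d 0 + d 2 := by
  have h01 : (0 : Fin 3) ≠ 1 := by decide
  have h12 : (1 : Fin 3) ≠ 2 := by decide
  have h02 : (0 : Fin 3) ≠ 2 := by decide
  simp only [symbPow, P_pow_eq_wIdeal h01, P_pow_eq_wIdeal h12, P_pow_eq_wIdeal h02, Ideal.mem_inf, mem_wIdeal_iff,
    pairWeight_apply]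
  constructor
  · rintro ⟨⟨h1, h2⟩, h3⟩ d hd
    exact ⟨h1 d hd, h2 d hd, h3 d hd⟩
  · intro h
    exact ⟨⟨fun d hd => (h d hd).1, fun d hd => (h d hd).2.1⟩, fun d hd => (h d hd).2.2⟩

/-- A monomial with `n ≤ d₀+d₁`, `n ≤ d₁+d₂`, `n ≤ d₀+d₂` lies in `I^{(n)}`. -/
theorem monomial_mem_symbPow {n : ℕ} {d : Fin 3 →₀ ℕ} (h01 : n ≤ d 0 + d 1) (h12 : n ≤ d 1 + d 2) (h02 : n ≤ d 0 + d 2)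
    (c : k) : monomial d c ∈ symbPow n := by
  classical
  rw [mem_symbPow_iff]
  intro e he
  rw [support_monomial] at he
  split_ifs at he with hc
  · simp at he
  · rw [Finset.mem_singleton] at he
    subst he
    exact ⟨h01, h12, h02⟩

/-- `I^{(n)}` contains every `f` all of whose monomials it contains (monomial-wise membership). -/
theorem symbPow_le_of_monomial_mem {n : ℕ} {J : Ideal (R k)}
    (h : ∀ d : Fin 3 →₀ ℕ, n ≤ d 0 + d 1 → n ≤ d 1 + d 2 → n ≤ d 0 + d 2 → monomial d (1 : k) ∈ J) :
    symbPow n ≤ J := by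
  intro f hf
  rw [mem_symbPow_iff] at hf
  rw [as_sum f]
  refine Submodule.sum_mem _ fun d hd => ?_
  have h1 : monomial d (coeff d f) = C (coeff d f) * monomial d (1 : k) := by
    rw [C_mul_monomial, mul_one]
  rw [h1]
  obtain ⟨a, b, c⟩ := hf d hd
  exact Ideal.mul_mem_left _ _ (h d a b c)

/-- `I^{(a)} · I^{(b)} ⊆ I^{(a+b)}` (the symbolic powers form a graded family). -/
theorem symbPow_mul_le (a b : ℕ) : symbPow (k := k) a * symbPow b ≤ symbPow (a + b) := by
  classical
  rw [Ideal.mul_le]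
  intro f hf g hg
  rw [mem_symbPow_iff] at hf hg ⊢
  intro d hd
  obtain ⟨u, hu, v, hv, rfl⟩ := Finset.mem_add.mp (support_mul f g hd)
  obtain ⟨a1, a2, a3⟩ := hf u hu
  obtain ⟨b1, b2, b3⟩ := hg v hv
  simp only [Finsupp.coe_add, Pi.add_apply]
  omega

/-- `(I^{(a)})^m ⊆ I^{(m·a)}`. -/
theorem symbPow_pow_le (a m : ℕ) : symbPow (k := k) a ^ m ≤ symbPow (m * a) := by
  induction m with
  | zero =>
    intro f _
    rw [zero_mul, mem_symbPow_iff]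
    intro d _
    simp
  | succ m ih =>
    rw [pow_succ, Nat.succ_mul]
    exact le_trans (Ideal.mul_mono_left ih) (symbPow_mul_le (m * a) a)

/-- `I^{(0)} = k[x,y,z]`. -/
theorem symbPow_zero : symbPow (k := k) 0 = ⊤ := by
  simp [symbPow]

/-- The generators of `I` lie in `I^{(1)}` — indeed `X_i X_j ∈ I^{(1)}`. -/
theorem I_le_symbPow_one : I (k := k) ≤ symbPow 1 := by
  rw [I, Ideal.span_le]
  intro f hf
  simp only [Set.mem_insert_iff, Set.mem_singleton_iff] at hf
  rw [SetLike.mem_coe]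
  rcases hf with rfl | rfl | rfl
  · have : (X 0 * X 1 : R k) = monomial (Finsupp.single 0 1 + Finsupp.single 1 1) 1 := by
      rw [X, X, monomial_mul, mul_one]
    rw [this]; exact monomial_mem_symbPow (by simp) (by simp) (by simp) 1
  · have : (X 1 * X 2 : R k) = monomial (Finsupp.single 1 1 + Finsupp.single 2 1) 1 := by
      rw [X, X, monomial_mul, mul_one]
    rw [this]; exact monomial_mem_symbPow (by simp) (by simp) (by simp) 1
  · have : (X 0 * X 2 : R k) = monomial (Finsupp.single 0 1 + Finsupp.single 2 1) 1 := by
      rw [X, X, monomial_mul, mul_one]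
    rw [this]; exact monomial_mem_symbPow (by simp) (by simp) (by simp) 1

/-- The exponent `(1,1,1)` of `xyz`. -/
def e111 : Fin 3 →₀ ℕ := Finsupp.single 0 1 + Finsupp.single 1 1 + Finsupp.single 2 1

/-- Every coordinate of `(1,1,1)` is `1`. -/
@[simp] theorem e111_apply (l : Fin 3) : e111 l = 1 := by
  fin_cases l <;> simp [e111]

/-- `xyz` as a monomial. -/
theorem X012_eq : (X 0 * X 1 * X 2 : R k) = monomial e111 1 := by
  rw [e111, X, X, X, monomial_mul, monomial_mul, mul_one, mul_one]

/-- `xyz ∈ I^{(2)}`. -/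
theorem X012_mem_symbPow_two : (X 0 * X 1 * X 2 : R k) ∈ symbPow 2 := by
  rw [X012_eq]
  exact monomial_mem_symbPow (by simp) (by simp) (by simp) 1

/-- Peeling a divisor off a monomial: `X^d = X^e · X^{d−e}` for `e ≤ d`. -/
theorem monomial_eq_mul_of_le {e d : Fin 3 →₀ ℕ} (h : e ≤ d) :
    monomial d (1 : k) = monomial e 1 * monomial (d - e) 1 := by
  rw [monomial_mul, mul_one, add_tsub_cancel_of_le h]

/-- `X_i X_j` as a monomial. -/
theorem X_mul_X_eq (i j : Fin 3) : (X i * X j : R k) = monomial (Finsupp.single i 1 + Finsupp.single j 1) 1 := by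
  rw [X, X, monomial_mul, mul_one]

/-- A monomial divisible by a generator `X_i X_j` of `I` times a monomial of `J` lies in `I · J`. -/
theorem monomial_mem_I_mul {J : Ideal (R k)} {d : Fin 3 →₀ ℕ} (i j : Fin 3)
    (hgen : (X i * X j : R k) ∈ I) (hle : Finsupp.single i 1 + Finsupp.single j 1 ≤ d)
    (hJ : monomial (d - (Finsupp.single i 1 + Finsupp.single j 1)) (1 : k) ∈ J) : monomial d (1 : k) ∈ I * J := by
  rw [monomial_eq_mul_of_le hle, ← X_mul_X_eq]
  exact Ideal.mul_mem_mul hgen hJ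

/-- `X₀X₁ ∈ I`. -/ theorem X01_mem_I : (X 0 * X 1 : R k) ∈ I := Ideal.subset_span (by simp)
/-- `X₁X₂ ∈ I`. -/ theorem X12_mem_I : (X 1 * X 2 : R k) ∈ I := Ideal.subset_span (by simp)
/-- `X₀X₂ ∈ I`. -/ theorem X02_mem_I : (X 0 * X 2 : R k) ∈ I := Ideal.subset_span (by simp)

/-- **`I^{(1)} = I`**: the radical ideal of the three axes IS `(xy, yz, zx)` (a monomial with at least two of `d₀,d₁,d₂`
positive is a multiple of a generator). -/
theorem symbPow_one : symbPow (k := k) 1 = I := by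
  classical
  refine le_antisymm (symbPow_le_of_monomial_mem fun d h01 h12 h02 => ?_) I_le_symbPow_one
  rw [← Ideal.mul_top (I (k := k))]
  -- two of the three exponents are positive: the monomial is a multiple of a generator
  by_cases h0 : d 0 = 0
  · exact monomial_mem_I_mul 1 2 X12_mem_I (fun l => by fin_cases l <;> simp <;> omega) Submodule.mem_top
  · by_cases h1 : d 1 = 0
    · exact monomial_mem_I_mul 0 2 X02_mem_I (fun l => by fin_cases l <;> simp <;> omega) Submodule.mem_top
    · exact monomial_mem_I_mul 0 1 X01_mem_I (fun l => by fin_cases l <;> simp <;> omega) Submodule.mem_top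

/-- **The symbolic Rees algebra is generated by `I` (degree 1) and `xyz` (degree 2)**, recursive form:
`I^{(n+2)} = I · I^{(n+1)} + (xyz) · I^{(n)}`. -/
theorem symbPow_succ_succ (n : ℕ) :
    symbPow (k := k) (n + 2) = I * symbPow (n + 1) ⊔ Ideal.span {X 0 * X 1 * X 2} * symbPow n := by
  classical
  refine le_antisymm (symbPow_le_of_monomial_mem fun d h01 h12 h02 => ?_) ?_
  · -- a monomial of `I^{(n+2)}`: either all exponents positive (factor `xyz`) or one vanishes (factor a generator of `I`)
    by_cases hpos : 1 ≤ d 0 ∧ 1 ≤ d 1 ∧ 1 ≤ d 2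
    · have hle : e111 ≤ d := by
        intro l; fin_cases l <;> simp [hpos.1, hpos.2.1, hpos.2.2]
      have hmon : monomial d (1 : k) = (X 0 * X 1 * X 2) * monomial (d - e111) 1 := by
        rw [X012_eq, monomial_mul, mul_one, add_tsub_cancel_of_le hle]
      rw [hmon]
      refine Ideal.mem_sup_right (Ideal.mul_mem_mul (Ideal.subset_span (by simp)) ?_)
      refine monomial_mem_symbPow ?_ ?_ ?_ 1 <;>
        simp only [Finsupp.coe_tsub, Pi.sub_apply, e111_apply] <;> omega
    · -- one exponent is `0`; the other two are `≥ n+2 ≥ 1`: factor a generator of `I`, the cofactor lies in `I^{(n+1)}`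
      refine Ideal.mem_sup_left ?_
      have aux : ∀ (i j l : Fin 3), n + 2 ≤ d i → n + 2 ≤ d j → d l = 0 → i ≠ j → i ≠ l → j ≠ l →
          (X i * X j : R k) ∈ I → monomial d (1 : k) ∈ I * symbPow (n + 1) := by
        intro i j l hi hj hl hij hil hjl hgen
        have hle : Finsupp.single i 1 + Finsupp.single j 1 ≤ d := by
          intro t
          simp only [Finsupp.coe_add, Pi.add_apply, Finsupp.single_apply]
          split_ifs <;> subst_vars <;> omega
        refine monomial_mem_I_mul i j hgen hle (monomial_mem_symbPow ?_ ?_ ?_ 1) <;>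
          simp only [Finsupp.coe_tsub, Finsupp.coe_add, Pi.sub_apply, Pi.add_apply, Finsupp.single_apply] <;>
          (fin_cases i <;> fin_cases j <;> fin_cases l <;> simp at hij hil hjl ⊢ <;> omega)
      by_cases h0 : d 0 = 0
      · exact aux 1 2 0 (by omega) (by omega) h0 (by decide) (by decide) (by decide) X12_mem_I
      · by_cases h1 : d 1 = 0
        · exact aux 0 2 1 (by omega) (by omega) h1 (by decide) (by decide) (by decide) X02_mem_I
        · exact aux 0 1 2 (by omega) (by omega) (by omega) (by decide) (by decide) (by decide) X01_mem_I
  · -- the easy inclusion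
    refine sup_le ?_ ?_
    · calc I * symbPow (n + 1) ≤ symbPow 1 * symbPow (n + 1) := Ideal.mul_mono_left I_le_symbPow_one
        _ ≤ symbPow (1 + (n + 1)) := symbPow_mul_le 1 (n + 1)
        _ = symbPow (n + 2) := by rw [show 1 + (n + 1) = n + 2 by ring]
    · have hx : Ideal.span {(X 0 * X 1 * X 2 : R k)} ≤ symbPow 2 := by
        rw [Ideal.span_le, Set.singleton_subset_iff]
        exact X012_mem_symbPow_two
      calc Ideal.span {(X 0 * X 1 * X 2 : R k)} * symbPow n ≤ symbPow 2 * symbPow n := Ideal.mul_mono_left hx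
        _ ≤ symbPow (2 + n) := symbPow_mul_le 2 n
        _ = symbPow (n + 2) := by rw [add_comm]

/-- **`I^{(2)} = I² + (xyz)`**. -/
theorem symbPow_two : symbPow (k := k) 2 = I ^ 2 ⊔ Ideal.span {X 0 * X 1 * X 2} := by
  rw [symbPow_succ_succ 0, zero_add, symbPow_one, symbPow_zero, Ideal.mul_top, pow_two]

end ThreeLines

end CampaignW36

end Summit.ResolutionOfSingularities.ResolutionOfSingularities.Theorems

end
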